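import Summits.BirchSwinnertonDyer.BirchSwinnertonDyer.Theorems.KatoDescentTamePotSupersingularTameLowerFouquetRoadCited
import Literature.NumberTheory.EllipticCurves.Fouquet2025.CongruenceTransportAnyReduction
import Literature.NumberTheory.EllipticCurves.Fouquet2025.OrdinaryCongruenceRankZeroBSDSigma
import Literature.NumberTheory.EllipticCurves.Fouquet2025.OrdinaryCongruenceRankZeroBSDNakamura
import Literature.NumberTheory.EllipticCurves.BSDSelmerPConverseSerreProofs
import HarnessLib

/-!
# Route `KatoDescentTamePotSupersingular` (rung K8-t′, cell `bsd-potss`): the Fouquet seed road RE-LANDED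
# over the Tate-form Ass. 3.4 binder (director R-05 / bsd-littype-07) — L₀ and BSD_p on the (t′) rank-0
# rows at `p ≥ 5` carrying a congruent good-ordinary Skinner–Urban seed, from the cite-level fact (A)
# `Fouquet2025.padicValRat_bsd_rank_zero_of_ordinaryCongruence_anyReduction` (p455826)
# (a `--supports … --as helper` file; items 19618 `TameLowerIntrinsicNonCM` / 19981 `TameLowerHalfRankZero`)

WHY THIS FILE. The seed roads of this seat's base (`…TameLowerFouquetRoadCited{,Surj,Sigma,Nakamura}.lean`,
p446605 / p448267 / p449887 / p452635) consume composite reading facts whose Ass.-3.4 binder is the route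
predicate `FouquetEligibleAt p W` («`u_q = Δ_min q^{-v_q(Δ_min)}` is not a `p`-th power mod `q`» at a
level-lowering multiplicative prime `q ≡ 1 (mod p)`). The typing layer (seat bsd-littype-07, 2026-08-26;
director-bsd ARM P register R-05) showed that this is the PRINTED clause (5)(b) «`ρ̄(Frob_q)` not
diagonalizable» only at `p = 3`: by Tate's parametrisation (Silverman ATAEC V.3.1/V.5.1/V.5.3/V.6.1) the
unit part of the Tate parameter is `u_q/c₄³`, so print reads «`u_q/c₄³` is not a `p`-th power mod `q`»,
and `c₄³` is a cube but not in general a fifth power. The corrected predicate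
`Fouquet2025.Assumption34TateAt` and the any-reduction transport fact (A) landed in
`Literature/…/Fouquet2025/CongruenceTransportAnyReduction.lean` (p455826). This file is the road over (A):

* §0 the scope bridge `FouquetEligibleAt 3 W → Fouquet2025.Assumption34TateAt 3 W` (at `p = 3` the two Kummer
  clauses agree up to the cube `c₄³`; planner g16 tree ask (1) — the Defs file itself is left untouched to spare its importers a
  rebuild during the farm lag; the docstring pointer can be appended there at a quiet time);
* §1 per pair (any reduction type of `W` at `p ≥ 5`; no additivity binder is needed by (A)): the print
  shape `PPartRankZero W p`, Miller's `BSDp W p`, both typed halves `MissingPPartAt W p` and the crux's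
  currency `MissingLowerBoundAt W p`, from (A) + modularity + GZK, for `W` with `ρ̄_{W,p}` onto, Ass. 2.9 (2)
  exact (`FouquetGenericAt p W`, definitionally (A)'s `ΨSq_p` clause), `Assumption34TateAt p W`, and a
  level-compatible congruent seed `G` (`GoodOrd`, `Irr`, `Ram`, tower onto, `IsCongruentModP`,
  `FouquetLevelCompatibleAt` — definitionally (A)'s seed binders);
* §2 the ROW FORMS over (A) for the 19618 skeleton (strict-Σ seed rows): L₀ / `MissingPPartAt` on every
  (t′) rank-`0` row at `p ≥ 5` with `Surj W p`, `FouquetGenericAt p W`, `Assumption34TateAt p W` and a seed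
  displayed by `GoodOrd ∧ Surj ∧ Ram ∧ IsCongruentModP ∧ FouquetLevelCompatibleAt` (`Irr G p` and the tower
  surjectivity DERIVED from `Surj G p` at `p ≥ 5` by Serre's lemma, as in p448267).

* §3 the ROW FORMS over the corrected Σ-form and Nakamura-form twins `…_sigma_tate` / `…_nakamura_tate` (ARM P typer
  bsd-cited-ty3, appended to the two Literature files; binders = p449673 / p452337 with `Assumption34TateAt p W`,
  `Assumption34TateAt p G`) = the EXACT v5 re-base of the skeleton's `SeedRowB` / `SeedRowA` (tier B / tier A).

WHAT (A) DOES NOT CARRY, and the census. Fact (A) is the STRICT-`Σ` form (every bad prime `q ≠ p` of `G`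
divides `N_W`) and has NO clause `p ∤ a_p(G)² − 1` (Nakamura 2023 Thm 1.1 (4)) and no `Σ`-form
(level-raising seeds): littype-07 reads Kato §17.13 from (12.5.2) alone; this seat's D-AUDIT §1d (g5) tiers
the rows by the zeta-morphism input of Fouquet's Thm 2.10 (tier A `a₅(G) ≡ ±2`: Nakamura, refereed; tier B
`≡ ±1`: Colmez–Wang preprint). Which reading is print is the referee's call (referee C, wake
`WAKE-AUDIT-POTSS-L2star5-Fouquet25`); the road below is agnostic (the tier is a property of the seed,
recorded per row in the census). RE-SCREEN of the census column C with the Tate test (this seat, g6,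
`census/D-AUDIT-L2star5-rows-k8t-c2-g6-c4cube.tsv` sha16 23b2f3685a1f8aee, delta
`census/RESCREEN-c4cube-delta.json`): the 85 CONTENT rows of `L_{II*,5}` are UNCHANGED (seeded 64 = tier A
38 / tier B 26; content-residue seeded 53 = A 32 / B 21 — the D-AUDIT v4 proposal stands); among the
NON-content rows 9 enter the cell (old test failed at `q = 11` ×8 / `q = 41`; 8 of them with a strict seed)
and 1 leaves (206800cu1, `q = 11`), 2 gain a `Σ`-seed; cell size 429 → 437, seeded rows 356 → 365.

HONEST FRAMING: conditional on a cite-level reading fact (no `_holds`: Taylor–Wiles–Kisin patching, the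
zeta morphism of Thm 2.10, Skinner–Urban's Eisenstein congruences are programme-sized); items 19618 / 19981
are NOT closed (their class statement — Kato's Conj. 12.10 lower inclusion at an additive potentially
supersingular prime — is open off the seed rows); nothing is booked; BSD is not proved by any of this.
The older roads stay in the tree unchanged (their facts' Ass.-3.4 clause is flagged STRONGER-THAN-PRINT at
`p ≥ 5` on the rows with a Tate prime `q ≡ 1 (mod p)`, `p ∣ v_q(Δ_min)`; exact elsewhere). Seat
`bsd-potss-k8t-c2` (prover-bsd-potss-k8t-c2-g6-0).

References: [Fouquet2025EquivariantTNC] Ass. 2.9, §2.4.1 (p. 15), Ass. 3.4 (pp. 22–23), Thm 4.1 (pp. 24–25),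
Thm 1.7 (2) (p. 7), §2.2 (p. 12); [SkinnerUrban2014] Thm 3.6.9 (p. 45); [Kato2004Asterisque] Conj. 12.10
(p. 224), §17.13 (pp. 279–280); [Silverman1994] Thm V.3.1, Lemma V.5.1, Thm V.5.3, Prop. V.6.1;
[SerreAbelianLadic1968] Ch. IV §3.4 Lemma 3; [Miller2011LMS] Def. 1.1.
-/

set_option autoImplicit false
-- sibling precedent (`KatoDescentTamePotSupersingularTameLowerFouquetRoadCited.lean`): the directory name repeats the summit name
set_option linter.dupNamespace false

noncomputable section

open scoped Classical

namespace Summit.BirchSwinnertonDyer.BirchSwinnertonDyer.Theorems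

open WeierstrassCurve Literature.NumberTheory.EllipticCurves
  Literature.NumberTheory.EllipticCurves.ModularForms
  Literature.NumberTheory.EllipticCurves.Rank1Residual
  Literature.NumberTheory.EllipticCurves.Rank1Residual.Typed
  Summit.BirchSwinnertonDyer.Rank1Residual.Additive
  Summit.BirchSwinnertonDyer.Rank1Residual
  Summit.BirchSwinnertonDyer.BirchSwinnertonDyer.Theses.KatoDescentTamePotSupersingular

/-! ## §0 Scope bridge between the two Ass.-3.4 predicates (planner g16 tree ask (1)) -/

section Bridge

variable (W : WeierstrassCurve ℚ) [W.IsGloballyMinimal]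

/-- **Scope bridge `FouquetEligibleAt` ↔ `Fouquet2025.Assumption34TateAt`.** The route predicate
`FouquetEligibleAt p W` (Defs §1: «`u_q` is not a `p`-th power mod `q`») and the Literature predicate
`Fouquet2025.Assumption34TateAt p W` («`u_q/c₄³` is not a `p`-th power mod `q`», the PRINTED clause (5)(b)
via Tate's parametrisation) carry the same quantifier prefix and the same oddness conjunct; they differ in
the Kummer clause by the factor `c₄³`. SCOPE FLAG: at `p ≥ 5` use `Assumption34TateAt` (this file's roads);
`FouquetEligibleAt` is print-faithful at `p = 3` only, where `c₄³ = c₄^p` is itself a cube — and in that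
case the route predicate IMPLIES the Literature one with no unit hypothesis on `c₄` (if `x³·c₄³ = u_q` then
`(x·c₄)³ = u_q`), which is the direction the roads consume. (The converse at `p = 3` needs `c₄` to be a
`q`-unit, true at a multiplicative prime; not needed here.) Pure algebra; nothing cited beyond the two
definitions. [cite: Fouquet2025EquivariantTNC, Ass. 3.4 (pp. 22–23)] [cite: Silverman1994, Lemma V.5.1] -/
theorem assumption34TateAt_three_of_fouquetEligibleAt_three (h : FouquetEligibleAt 3 W) :
    Fouquet2025.Assumption34TateAt 3 W := by
  intro q _ hq hmult hdvd
  obtain ⟨hodd, hk⟩ := h q hq hmult hdvd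
  refine ⟨hodd, fun h1 hx => hk h1 ?_⟩
  obtain ⟨x, hx⟩ := hx
  refine ⟨x * ((W.integralModelInt.c₄ : ℤ) : ZMod q), ?_⟩
  rw [mul_pow, ← hx]
  push_cast
  ring

end Bridge

/-! ## §1 Per pair: print shape, BSD_p, both halves, L₀ — from fact (A) -/

section PerPair

variable (W G : WeierstrassCurve ℚ) [W.IsElliptic] [W.IsGloballyMinimal] [G.IsElliptic] [G.IsGloballyMinimal]
  (p : ℕ) [Fact p.Prime]

/-- **Bridge (definitional): fact (A)'s binders are the route's census predicates unfolded, its conclusion is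
`PPartRankZero W p` unfolded.** For `W` of ANY reduction type at `p ≥ 5` with `ρ̄_{W,p}` onto, Ass. 2.9 (2)
exact (`FouquetGenericAt`), Ass. 3.4 in Tate form (`Assumption34TateAt`), and a level-compatible congruent
good-ordinary seed `G` (`GoodOrd`, `Irr`, `Ram`, `ρ_{G,p^∞}` onto, `IsCongruentModP`,
`FouquetLevelCompatibleAt`), `L(W,1) ≠ 0` and `Ш(W)` finite: the print shape of the `p`-part of BSD in rank
`0`. Conditional on the cite-level fact `hA`; nothing credited.
[cite: Fouquet2025EquivariantTNC, Thm 4.1 (1)⇒(2) and Thm 1.7 (2)] [cite: SkinnerUrban2014, Thm 3.6.9 (p. 45)] -/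
theorem pPartRankZero_of_fouquetCongruenceTate
    (hA : Fouquet2025.padicValRat_bsd_rank_zero_of_ordinaryCongruence_anyReduction) (hp : 5 ≤ p)
    (hsurj : Surj W p) (hgen : FouquetGenericAt p W) (h34 : Fouquet2025.Assumption34TateAt p W)
    (hord : GoodOrd G p) (hirrG : Irr G p) (hramG : Ram G p)
    (htowG : ∀ n : ℕ, G.HasSurjectiveModNGaloisRep (p ^ n : ℕ)) (hcong : IsCongruentModP p W G)
    (hlev : FouquetLevelCompatibleAt p W G) (hL : W.entireLFunction 1 ≠ 0) (hfin : Finite W.sha) :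
    PPartRankZero W p :=
  hA W G p hp hsurj hgen h34 hord.1 hord.2 hirrG hramG htowG hcong hlev hL hfin

/-- **Miller's `BSD(W,p)` on a rank-`0` row at `p ≥ 5` with a congruent good-ordinary seed, Ass. 3.4 in
Tate form** — from (A) + modularity (`L(W,1) = L^{(0)}(W,1) ≠ 0`) + Gross–Zagier–Kolyvagin (`Ш` finite, rank
`0`), via `bsdp_of_pPartRankZero`. Conditional; nothing credited.
[cite: Fouquet2025EquivariantTNC, Thm 1.7 (2) (p. 7)] [cite: Miller2011LMS, Def. 1.1] -/
theorem bsdp_rankZero_of_fouquetCongruenceTate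
    (hA : Fouquet2025.padicValRat_bsd_rank_zero_of_ordinaryCongruence_anyReduction)
    (hmod : hasEntireLFunction_rat) (hGZK : rank_eq_analyticRank_of_analyticRank_le_one) (hp : 5 ≤ p)
    (hr : W.analyticRank = 0) (hsurj : Surj W p) (hgen : FouquetGenericAt p W)
    (h34 : Fouquet2025.Assumption34TateAt p W) (hord : GoodOrd G p) (hirrG : Irr G p) (hramG : Ram G p)
    (htowG : ∀ n : ℕ, G.HasSurjectiveModNGaloisRep (p ^ n : ℕ)) (hcong : IsCongruentModP p W G)
    (hlev : FouquetLevelCompatibleAt p W G) : BSDp W p := by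
  have hfin : Finite W.sha := (hGZK W (by omega)).2
  have hL : W.entireLFunction 1 ≠ 0 := by
    rw [← W.leadingLCoeff_eq_of_analyticRank_eq_zero hr]
    exact W.leadingLCoeff_ne_zero_holds (hmod W)
  exact bsdp_of_pPartRankZero W p hmod hGZK hr
    (pPartRankZero_of_fouquetCongruenceTate W G p hA hp hsurj hgen h34 hord hirrG hramG htowG hcong hlev
      hL hfin)

/-- **`MissingPPartAt W p` — BOTH halves — on a rank-`0` row at `p ≥ 5` with a congruent good-ordinary seed,
Ass. 3.4 in Tate form.** Conditional on (A); nothing credited.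
[cite: Fouquet2025EquivariantTNC, Thm 1.7 (2) (p. 7)] [cite: Miller2011LMS, Def. 1.1] -/
theorem missingPPartAt_rankZero_of_fouquetCongruenceTate
    (hA : Fouquet2025.padicValRat_bsd_rank_zero_of_ordinaryCongruence_anyReduction)
    (hmod : hasEntireLFunction_rat) (hGZK : rank_eq_analyticRank_of_analyticRank_le_one) (hp : 5 ≤ p)
    (hr : W.analyticRank = 0) (hsurj : Surj W p) (hgen : FouquetGenericAt p W)
    (h34 : Fouquet2025.Assumption34TateAt p W) (hord : GoodOrd G p) (hirrG : Irr G p) (hramG : Ram G p)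
    (htowG : ∀ n : ℕ, G.HasSurjectiveModNGaloisRep (p ^ n : ℕ)) (hcong : IsCongruentModP p W G)
    (hlev : FouquetLevelCompatibleAt p W G) : MissingPPartAt W p := by
  haveI : Finite W.sha := (hGZK W (by omega)).2
  exact missingPPartAt_of_bsdp W p
    (bsdp_rankZero_of_fouquetCongruenceTate W G p hA hmod hGZK hp hr hsurj hgen h34 hord hirrG hramG htowG
      hcong hlev)

/-- **The crux's currency `MissingLowerBoundAt W p` on a rank-`0` row at `p ≥ 5` with a congruent
good-ordinary seed, Ass. 3.4 in Tate form.** Conditional on (A); the items are NOT closed.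
[cite: Fouquet2025EquivariantTNC, Thm 4.1 (pp. 24–25)] [cite: Miller2011LMS, Def. 1.1] -/
theorem missingLowerBoundAt_rankZero_of_fouquetCongruenceTate
    (hA : Fouquet2025.padicValRat_bsd_rank_zero_of_ordinaryCongruence_anyReduction)
    (hmod : hasEntireLFunction_rat) (hGZK : rank_eq_analyticRank_of_analyticRank_le_one) (hp : 5 ≤ p)
    (hr : W.analyticRank = 0) (hsurj : Surj W p) (hgen : FouquetGenericAt p W)
    (h34 : Fouquet2025.Assumption34TateAt p W) (hord : GoodOrd G p) (hirrG : Irr G p) (hramG : Ram G p)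
    (htowG : ∀ n : ℕ, G.HasSurjectiveModNGaloisRep (p ^ n : ℕ)) (hcong : IsCongruentModP p W G)
    (hlev : FouquetLevelCompatibleAt p W G) : MissingLowerBoundAt W p :=
  (lower_and_upper_of_missingPPartAt W p
    (missingPPartAt_rankZero_of_fouquetCongruenceTate W G p hA hmod hGZK hp hr hsurj hgen h34 hord hirrG hramG
      htowG hcong hlev)).1

end PerPair

/-! ## §2 Row forms for the 19618 skeleton (seed displayed by `GoodOrd ∧ Surj ∧ Ram` + congruence + level) -/

/-- **L₀ on every (t′) rank-`0` row at `p ≥ 5` with `ρ̄` onto, Ass. 2.9 (2) exact and Ass. 3.4 IN TATE FORM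
that has a level-compatible congruent good-ordinary Skinner–Urban seed displayed by `GoodOrd ∧ Surj ∧ Ram`**
(`Irr G p` and the tower surjectivity DERIVED from `Surj G p`, `p ≥ 5`: Serre's lemma
`serre_hasSurjectiveModNGaloisRep_pow_holds`, `hasIrreducibleModPGaloisRep_of_hasSurjectiveModNGaloisRep`) —
the v5 re-base of the skeleton's seed rows asked by the planner (proviso v4.1): VERBATIM
`tameLowerHalf_fouquetSeedRows_of_fact_of_surjSeed` (p448267) with `FouquetEligibleAt p W` replaced by
`Fouquet2025.Assumption34TateAt p W` and the fact by (A). The (t′) binders `Addv`/`SubTprime` are carried for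
the item's shape and are idle ((A) is reduction-free). Conditional on `hA`; nothing credited; items NOT closed.
[cite: Fouquet2025EquivariantTNC, Thm 4.1 and Thm 1.7 (2)] [cite: SkinnerUrban2014, Thm 3.6.9 (p. 45)]
[cite: SerreAbelianLadic1968, Ch. IV §3.4 Lemma 3] [cite: Miller2011LMS, Def. 1.1] -/
theorem tameLowerHalf_fouquetSeedRows_of_anyReductionFact
    (hA : Fouquet2025.padicValRat_bsd_rank_zero_of_ordinaryCongruence_anyReduction)
    (hGZK : rank_eq_analyticRank_of_analyticRank_le_one) (hmod : hasEntireLFunction_rat) :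
    ∀ (W : WeierstrassCurve ℚ) [W.IsElliptic] [W.IsGloballyMinimal] (p : ℕ) [Fact p.Prime],
      W.analyticRank = 0 → 5 ≤ p → Addv W p → SubTprime W p → Surj W p → FouquetGenericAt p W →
      Fouquet2025.Assumption34TateAt p W →
      (∃ (G : WeierstrassCurve ℚ) (_ : G.IsElliptic) (_ : G.IsGloballyMinimal),
        GoodOrd G p ∧ Surj G p ∧ Ram G p ∧ IsCongruentModP p W G ∧ FouquetLevelCompatibleAt p W G) →
      MissingLowerBoundAt W p := by
  intro W _ _ p _ hr hp _ _ hsurj hgen h34 hseed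
  obtain ⟨G, hGe, hGm, hord, hsurjG, hramG, hcong, hlev⟩ := hseed
  exact missingLowerBoundAt_rankZero_of_fouquetCongruenceTate W G p hA hmod hGZK hp hr hsurj hgen h34 hord
    (hasIrreducibleModPGaloisRep_of_hasSurjectiveModNGaloisRep G p hsurjG) hramG
    (serre_hasSurjectiveModNGaloisRep_pow_holds G p hp hsurjG) hcong hlev

/-- **Both halves (`MissingPPartAt`, `ord_p #Ш = ord_p #Ш_an`) on the same rows** — the form the U₀ side
(item 19982 family) may consume on the seed rows: no `p ∤ Tam·c_D` proviso, no parity clause. Conditional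
on `hA`; nothing credited. [cite: Fouquet2025EquivariantTNC, Thm 1.7 (2) (p. 7)] [cite: Miller2011LMS, Def. 1.1] -/
theorem tameMissingPPartAt_fouquetSeedRows_of_anyReductionFact
    (hA : Fouquet2025.padicValRat_bsd_rank_zero_of_ordinaryCongruence_anyReduction)
    (hGZK : rank_eq_analyticRank_of_analyticRank_le_one) (hmod : hasEntireLFunction_rat) :
    ∀ (W : WeierstrassCurve ℚ) [W.IsElliptic] [W.IsGloballyMinimal] (p : ℕ) [Fact p.Prime],
      W.analyticRank = 0 → 5 ≤ p → Addv W p → SubTprime W p → Surj W p → FouquetGenericAt p W →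
      Fouquet2025.Assumption34TateAt p W →
      (∃ (G : WeierstrassCurve ℚ) (_ : G.IsElliptic) (_ : G.IsGloballyMinimal),
        GoodOrd G p ∧ Surj G p ∧ Ram G p ∧ IsCongruentModP p W G ∧ FouquetLevelCompatibleAt p W G) →
      MissingPPartAt W p := by
  intro W _ _ p _ hr hp _ _ hsurj hgen h34 hseed
  obtain ⟨G, hGe, hGm, hord, hsurjG, hramG, hcong, hlev⟩ := hseed
  exact missingPPartAt_rankZero_of_fouquetCongruenceTate W G p hA hmod hGZK hp hr hsurj hgen h34 hord
    (hasIrreducibleModPGaloisRep_of_hasSurjectiveModNGaloisRep G p hsurjG) hramG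
    (serre_hasSurjectiveModNGaloisRep_pow_holds G p hp hsurjG) hcong hlev

/-! ## §3 Row forms over the corrected Σ-form and Nakamura-form facts (`…_sigma_tate`, `…_nakamura_tate`,
ARM P typer bsd-cited-ty3) — the exact re-base targets of the skeleton's `SeedRowB` / `SeedRowA` -/

section TateTwins

variable (W G : WeierstrassCurve ℚ) [W.IsElliptic] [W.IsGloballyMinimal] [G.IsElliptic] [G.IsGloballyMinimal]
  (p : ℕ) [Fact p.Prime]

/-- **`MissingPPartAt W p` on an additive rank-`0` row at `p ≥ 5` with a congruent good-ordinary seed, Σ = primes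
(`p N_W N_G`) (level-RAISING seeds allowed), Ass. 3.4 in TATE FORM on `W` and on `G`** — from the corrected twin
`Fouquet2025.padicValRat_bsd_rank_zero_of_ordinaryCongruence_sigma_tate` (appended to `…/OrdinaryCongruenceRankZeroBSDSigma.lean`)
+ modularity + GZK; `Irr G p` and the tower DERIVED from `Surj G p`. VERBATIM p449887's chain with
`FouquetEligibleAt` ↦ `Assumption34TateAt`. Conditional on the cite-level fact `hF` (Colmez–Wang preprint inside
on the rows with `a_p(G)² ≡ 1 (mod p)`: flag `@Fouquet-2.10-via-ColmezWang-PRE`, referee C R327); nothing credited.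
[cite: Fouquet2025EquivariantTNC, Thm 4.1 (1)⇒(2), Thm 1.7 (2), Ass. 3.4 (pp. 22–23)] [cite: SkinnerUrban2014, Thm 3.6.9 (p. 45)]
[cite: Miller2011LMS, Def. 1.1] -/
theorem missingPPartAt_rankZero_of_fouquetCongruenceSigmaTate
    (hF : Fouquet2025.padicValRat_bsd_rank_zero_of_ordinaryCongruence_sigma_tate)
    (hmod : hasEntireLFunction_rat) (hGZK : rank_eq_analyticRank_of_analyticRank_le_one) (hp : 5 ≤ p)
    (hr : W.analyticRank = 0) (hadd : Addv W p) (hsurj : Surj W p) (hgen : FouquetGenericAt p W)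
    (h34 : Fouquet2025.Assumption34TateAt p W) (hord : GoodOrd G p) (hsurjG : Surj G p) (hramG : Ram G p)
    (hcong : IsCongruentModP p W G) (h34G : Fouquet2025.Assumption34TateAt p G) : MissingPPartAt W p := by
  have hfin : Finite W.sha := (hGZK W (by omega)).2
  have hL : W.entireLFunction 1 ≠ 0 := by
    rw [← W.leadingLCoeff_eq_of_analyticRank_eq_zero hr]
    exact W.leadingLCoeff_ne_zero_holds (hmod W)
  exact missingPPartAt_of_bsdp W p
    (bsdp_of_pPartRankZero W p hmod hGZK hr
      (hF W G p hp hadd.1 hadd.2 hsurj hgen h34 hord.1 hord.2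
        (hasIrreducibleModPGaloisRep_of_hasSurjectiveModNGaloisRep G p hsurjG) hramG
        (serre_hasSurjectiveModNGaloisRep_pow_holds G p hp hsurjG) hcong h34G hL hfin))

/-- **`MissingPPartAt W p`, Nakamura form** (`p ∤ a_p(G)² − 1`: the zeta morphism of Fouquet's Thm 2.10 is Nakamura
2023 Thm 1.1, published — tier A), Σ = primes(`p N_W N_G`), Ass. 3.4 in TATE FORM on `W` and on `G` — from the
corrected twin `Fouquet2025.padicValRat_bsd_rank_zero_of_ordinaryCongruence_nakamura_tate` + modularity + GZK.
VERBATIM p452635's chain with `FouquetEligibleAt` ↦ `Assumption34TateAt`. Conditional; nothing credited.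
[cite: Fouquet2025EquivariantTNC, Thm 4.1 (1)⇒(2), Thm 1.7 (2), Thm 2.10 (p. 15)] [cite: Nakamura2023ZetaMorphisms, Thm 1.1]
[cite: Miller2011LMS, Def. 1.1] -/
theorem missingPPartAt_rankZero_of_fouquetCongruenceNakamuraTate
    (hF : Fouquet2025.padicValRat_bsd_rank_zero_of_ordinaryCongruence_nakamura_tate)
    (hmod : hasEntireLFunction_rat) (hGZK : rank_eq_analyticRank_of_analyticRank_le_one) (hp : 5 ≤ p)
    (hr : W.analyticRank = 0) (hadd : Addv W p) (hsurj : Surj W p) (hgen : FouquetGenericAt p W)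
    (h34 : Fouquet2025.Assumption34TateAt p W) (hord : GoodOrd G p)
    (hnak : ¬ (p : ℤ) ∣ (G.frobeniusTrace p) ^ 2 - 1) (hsurjG : Surj G p) (hramG : Ram G p)
    (hcong : IsCongruentModP p W G) (h34G : Fouquet2025.Assumption34TateAt p G) : MissingPPartAt W p := by
  have hfin : Finite W.sha := (hGZK W (by omega)).2
  have hL : W.entireLFunction 1 ≠ 0 := by
    rw [← W.leadingLCoeff_eq_of_analyticRank_eq_zero hr]
    exact W.leadingLCoeff_ne_zero_holds (hmod W)
  exact missingPPartAt_of_bsdp W p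
    (bsdp_of_pPartRankZero W p hmod hGZK hr
      (hF W G p hp hadd.1 hadd.2 hsurj hgen h34 hord.1 hord.2 hnak
        (hasIrreducibleModPGaloisRep_of_hasSurjectiveModNGaloisRep G p hsurjG) hramG
        (serre_hasSurjectiveModNGaloisRep_pow_holds G p hp hsurjG) hcong h34G hL hfin))

end TateTwins

/-- **SeedRowB re-based (skeleton v5): L₀ on every (t′) rank-`0` row at `p ≥ 5` with `ρ̄` onto, Ass. 2.9 (2) exact,
Ass. 3.4 in Tate form, and a congruent good-ordinary seed displayed by
`GoodOrd ∧ Surj ∧ Ram ∧ IsCongruentModP ∧ Assumption34TateAt p G` (Σ-form, level-raising seeds allowed).**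
VERBATIM `tameLowerHalf_fouquetSeedRows_of_sigmaFact` (p449887) with both `FouquetEligibleAt` ↦ `Assumption34TateAt`.
Conditional on the cite-level fact `hF` (`…_sigma_tate`); nothing credited; items NOT closed.
[cite: Fouquet2025EquivariantTNC, Thm 4.1 and Thm 1.7 (2), Ass. 3.4 (pp. 22–23)] [cite: SkinnerUrban2014, Thm 3.6.9 (p. 45)]
[cite: Miller2011LMS, Def. 1.1] -/
theorem tameLowerHalf_fouquetSeedRows_of_sigmaTateFact
    (hF : Fouquet2025.padicValRat_bsd_rank_zero_of_ordinaryCongruence_sigma_tate)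
    (hGZK : rank_eq_analyticRank_of_analyticRank_le_one) (hmod : hasEntireLFunction_rat) :
    ∀ (W : WeierstrassCurve ℚ) [W.IsElliptic] [W.IsGloballyMinimal] (p : ℕ) [Fact p.Prime],
      W.analyticRank = 0 → 5 ≤ p → Addv W p → SubTprime W p → Surj W p → FouquetGenericAt p W →
      Fouquet2025.Assumption34TateAt p W →
      (∃ (G : WeierstrassCurve ℚ) (_ : G.IsElliptic) (_ : G.IsGloballyMinimal),
        GoodOrd G p ∧ Surj G p ∧ Ram G p ∧ IsCongruentModP p W G ∧ Fouquet2025.Assumption34TateAt p G) →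
      MissingLowerBoundAt W p := by
  intro W _ _ p _ hr hp hadd _ hsurj hgen h34 hseed
  obtain ⟨G, hGe, hGm, hord, hsurjG, hramG, hcong, h34G⟩ := hseed
  exact (lower_and_upper_of_missingPPartAt W p
    (missingPPartAt_rankZero_of_fouquetCongruenceSigmaTate W G p hF hmod hGZK hp hr hadd hsurj hgen h34 hord hsurjG
      hramG hcong h34G)).1

/-- **Both halves (`MissingPPartAt`) on the same rows (SeedRowB re-based).** Conditional; nothing credited.
[cite: Fouquet2025EquivariantTNC, Thm 1.7 (2) (p. 7)] [cite: Miller2011LMS, Def. 1.1] -/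
theorem tameMissingPPartAt_fouquetSeedRows_of_sigmaTateFact
    (hF : Fouquet2025.padicValRat_bsd_rank_zero_of_ordinaryCongruence_sigma_tate)
    (hGZK : rank_eq_analyticRank_of_analyticRank_le_one) (hmod : hasEntireLFunction_rat) :
    ∀ (W : WeierstrassCurve ℚ) [W.IsElliptic] [W.IsGloballyMinimal] (p : ℕ) [Fact p.Prime],
      W.analyticRank = 0 → 5 ≤ p → Addv W p → SubTprime W p → Surj W p → FouquetGenericAt p W →
      Fouquet2025.Assumption34TateAt p W →
      (∃ (G : WeierstrassCurve ℚ) (_ : G.IsElliptic) (_ : G.IsGloballyMinimal),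
        GoodOrd G p ∧ Surj G p ∧ Ram G p ∧ IsCongruentModP p W G ∧ Fouquet2025.Assumption34TateAt p G) →
      MissingPPartAt W p := by
  intro W _ _ p _ hr hp hadd _ hsurj hgen h34 hseed
  obtain ⟨G, hGe, hGm, hord, hsurjG, hramG, hcong, h34G⟩ := hseed
  exact missingPPartAt_rankZero_of_fouquetCongruenceSigmaTate W G p hF hmod hGZK hp hr hadd hsurj hgen h34 hord hsurjG
    hramG hcong h34G

/-- **SeedRowA re-based (skeleton v5): L₀ on every (t′) rank-`0` row at `p ≥ 5` with `ρ̄` onto, Ass. 2.9 (2) exact,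
Ass. 3.4 in Tate form, and a TIER-A seed displayed by
`GoodOrd ∧ p ∤ a_p(G)² − 1 ∧ Surj ∧ Ram ∧ IsCongruentModP ∧ Assumption34TateAt p G`** (refereed chain: S–U 2014 ·
Kato 2004 · Nakamura 2023 · Fouquet 2025 · Venjakob 2007). VERBATIM `tameLowerHalf_fouquetSeedRows_of_nakamuraFact`
(p452635) with both `FouquetEligibleAt` ↦ `Assumption34TateAt`. Conditional on `hF` (`…_nakamura_tate`); nothing
credited; items NOT closed. [cite: Fouquet2025EquivariantTNC, Thm 4.1 and Thm 1.7 (2)] [cite: Nakamura2023ZetaMorphisms, Thm 1.1]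
[cite: SkinnerUrban2014, Thm 3.6.9 (p. 45)] [cite: Miller2011LMS, Def. 1.1] -/
theorem tameLowerHalf_fouquetSeedRows_of_nakamuraTateFact
    (hF : Fouquet2025.padicValRat_bsd_rank_zero_of_ordinaryCongruence_nakamura_tate)
    (hGZK : rank_eq_analyticRank_of_analyticRank_le_one) (hmod : hasEntireLFunction_rat) :
    ∀ (W : WeierstrassCurve ℚ) [W.IsElliptic] [W.IsGloballyMinimal] (p : ℕ) [Fact p.Prime],
      W.analyticRank = 0 → 5 ≤ p → Addv W p → SubTprime W p → Surj W p → FouquetGenericAt p W →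
      Fouquet2025.Assumption34TateAt p W →
      (∃ (G : WeierstrassCurve ℚ) (_ : G.IsElliptic) (_ : G.IsGloballyMinimal),
        GoodOrd G p ∧ ¬ (p : ℤ) ∣ (G.frobeniusTrace p) ^ 2 - 1 ∧ Surj G p ∧ Ram G p ∧ IsCongruentModP p W G ∧
          Fouquet2025.Assumption34TateAt p G) →
      MissingLowerBoundAt W p := by
  intro W _ _ p _ hr hp hadd _ hsurj hgen h34 hseed
  obtain ⟨G, hGe, hGm, hord, hnak, hsurjG, hramG, hcong, h34G⟩ := hseed
  exact (lower_and_upper_of_missingPPartAt W p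
    (missingPPartAt_rankZero_of_fouquetCongruenceNakamuraTate W G p hF hmod hGZK hp hr hadd hsurj hgen h34 hord hnak
      hsurjG hramG hcong h34G)).1

/-- **Both halves (`MissingPPartAt`) on the same rows (SeedRowA re-based).** Conditional; nothing credited.
[cite: Fouquet2025EquivariantTNC, Thm 1.7 (2) (p. 7)] [cite: Miller2011LMS, Def. 1.1] -/
theorem tameMissingPPartAt_fouquetSeedRows_of_nakamuraTateFact
    (hF : Fouquet2025.padicValRat_bsd_rank_zero_of_ordinaryCongruence_nakamura_tate)
    (hGZK : rank_eq_analyticRank_of_analyticRank_le_one) (hmod : hasEntireLFunction_rat) :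
    ∀ (W : WeierstrassCurve ℚ) [W.IsElliptic] [W.IsGloballyMinimal] (p : ℕ) [Fact p.Prime],
      W.analyticRank = 0 → 5 ≤ p → Addv W p → SubTprime W p → Surj W p → FouquetGenericAt p W →
      Fouquet2025.Assumption34TateAt p W →
      (∃ (G : WeierstrassCurve ℚ) (_ : G.IsElliptic) (_ : G.IsGloballyMinimal),
        GoodOrd G p ∧ ¬ (p : ℤ) ∣ (G.frobeniusTrace p) ^ 2 - 1 ∧ Surj G p ∧ Ram G p ∧ IsCongruentModP p W G ∧
          Fouquet2025.Assumption34TateAt p G) →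
      MissingPPartAt W p := by
  intro W _ _ p _ hr hp hadd _ hsurj hgen h34 hseed
  obtain ⟨G, hGe, hGm, hord, hnak, hsurjG, hramG, hcong, h34G⟩ := hseed
  exact missingPPartAt_rankZero_of_fouquetCongruenceNakamuraTate W G p hF hmod hGZK hp hr hadd hsurj hgen h34 hord hnak
    hsurjG hramG hcong h34G

end Summit.BirchSwinnertonDyer.BirchSwinnertonDyer.Theorems

end
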